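import Summits.BirchSwinnertonDyer.BirchSwinnertonDyer.Theorems.AdditiveBranchIMCGordTwoRankZeroLambdaAdic
import Summits.BirchSwinnertonDyer.BirchSwinnertonDyer.Theorems.AdditiveBranchIMCGordTwoRankZeroLambdaAdicOdd
import Literature.NumberTheory.EllipticCurves.EmertonPollackWeston2006.BranchTransfer
import Literature.NumberTheory.EllipticCurves.LeadingTermPPartProofs
import HarnessLib

/-!
# Crux `GordTwoRankZeroOffCaseOne` (items 19357 / 19244 / 19245): a PUBLISHED road to the Λ-adic branch
# input on the irreducible rows — Emerton–Pollack–Weston 2006 Cor. 5.1.4 on the branch `ω^{(p−1)/2}`,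
# with a free base case from Kato at a congruent curve whose branch `p`-adic `L`-function is a unit

Cell `bsd-addord`, seat `bsd-addord-k1-c2` (D-0074 row B1), gen 2; sequel of
`AdditiveBranchIMCGordTwoRankZero{Transport,Exact,LambdaAdic,LambdaAdicOdd,Residual}`. HONEST FRAMING:
nothing here proves the Birch–Swinnerton-Dyer conjecture or the crux; every published input is an
explicit named-fact binder — Kato 2004 Thm. 17.4 (3) read on the `ω^{(p−1)/2}`-component (`hK`, the
tree's READING fact `Kato2004.charIdeal_dvd_padicLFunctionBranch_component_of_surjective`), the NEW
reading fact `EmertonPollackWeston2006.cor514_branchTransfer_of_torsionIso` (`hEPW`: Invent. Math. 163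
(2006) Cor. 5.1.4 + Thm. 5.1.3 on the branch `i = (p−1)/2`, between the weight-two members `f_{V₁}`,
`f_{V₂}` of the Hida family of `ρ̄ = V₁[p] ≅ V₂[p]`, same eigenspace reading as `hK`), and the route's
facts `hDelG hPal hGZK hmod hmodD`; and two PER-PAIR CERTIFICATES, displayed as binders and never
asserted: (C1) a `Γ_ℚ`-equivariant isomorphism `V₁[p] ≃ V[p]` from a fixed good ordinary PARTNER `V₁`
(with `ρ_{V₁,p^∞}` tower-surjective) to the good ordinary twist models `V` of the additive curve `W`,
(C2) the constant term of `ϖ₁·L_p(f_{V₁}, α₁, ω^{(p−1)/2}, T)` is a `p`-adic UNIT (one modular-symbol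
value: `L(V₁ ⊗ (·/p), 1)/Ω^±` up to the unit `α₁⁻¹`·Gauss-sum factor). Nothing is booked here.

THE ROAD (why it is a theorem scheme and what it reaches). On the branch `m = (p−1)/2` the main
conjecture for `f_V ⊗ ω^m` is EPW's statement 5.1.1; Kato's Thm. 5.1.2 gives one divisibility for every
member; so for a member `f_{V₁}` whose branch `p`-adic `L`-function is a UNIT of `Λ`, Kato's element is a
unit and 5.1.1 holds trivially with `μ = λ = 0` (§1, `branchCharIdealMuZeroEigen_of_katoComponent_of_unit`).
EPW Cor. 5.1.4 (branch `m`) then transports 5.1.1 — with `μ = 0` by Thm. 5.1.3 — to EVERY member of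
`H(ρ̄)`, in particular to the good ordinary twist model `V` of the additive curve `W = C • V^{(p*)}`
(§2), and the cell's prime-to-`p` descent (`SelmerDualData.exists_chiEigenInCyclotomic`, the proof of
gen 0's `exists_mem_charIdeal_eq_unit_mul_branch_of_katoComponent`) turns the eigenspace statement into
`char_Λ X(W/ℚ_∞) = (g)`, `ι g = ϖ·L_p(f_V, α, ω^m, T)` — the FULL branch main conjecture for `W`, hence
the Λ-adic lower input `ChiBranchLowerDivisibility[Odd]At W p` (§2) and, in analytic rank `0`, the lower
half `MissingLowerBoundAt W p` by gen 0's transport (§3). Reach (EPW Thm. 1 / §5): exactly the residual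
classes `ρ̄` with `μ(ρ̄, ω^m) = 0` and MINIMAL `λ(ρ̄, ω^m) = 0`, witnessed by a rational weight-two member
`V₁` (at `p = 5` the curves with `V₁[5] ≅ V[5]` form a rational family — Rubin–Silverberg — so partners
abound; at `p ≥ 7` they are sporadic); on a content row (`p ∣ #Ш(W)_an`) the conclusion is NOT trivial:
it forces `ord_p #Ш(W) ≥ ord_p #Ш(W)_an ≥ 1`. The same §2 output is the rank-free Λ-adic layer
`hΛ/hΛ'` of crux `GordTwoRankOne` (item 19358, k1-c3's residual (R1)) at the pair.

* §1 `branchCharIdealMuZeroEigen_of_katoComponent_of_unit` — base case at the partner (eigenspace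
  currency): `hK` + tower-surjectivity + (C2) ⟹ `EmertonPollackWeston2006.BranchCharIdealMuZeroEigen V₁ p`.
* §2 `chiBranchLowerDivisibilityAt_of_branchTransfer` (`p ≡ 1 (mod 4)`),
  `chiBranchLowerDivisibilityOddAt_of_branchTransfer` (`p ≡ 3 (mod 4)`, `p ≥ 7`): `hEPW` + the partner's
  5.1.1 + (C1) ⟹ the Λ-adic lower input at `(W, p)` (indeed `char X(W/ℚ_∞) = (g)`, `ι g = ϖ·L_br`).
* §3 `missingLowerBoundAt_rankZero_of_branchTransfer[_odd]` and the crux-row form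
  `missingLowerBoundAt_offCaseOne_rankZero_of_partner`: cell (G-ord, `e = 2`), `r_an = 0`, `p ≥ 5` ⟹
  `ord_p #Ш(W)_an ≤ ord_p #Ш(W)` from the facts and the two certificates.

References: Emerton–Pollack–Weston, Invent. Math. 163 (2006) Cor. 5.1.4, Thm. 5.1.3, Thm. 5.1.2
[EmertonPollackWeston2006]; Kato, Astérisque 295 (2004) Thm. 17.4 (3) [Kato2004Asterisque]; Greenberg,
LNM 1716 (1999) Prop. 2.4, §5 [GreenbergLNM1716]; Mazur–Tate–Teitelbaum 1986 §I.13–14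
[MazurTateTeitelbaum1986Invent]; Pal 2012 Thm. 3.2 [Pal2012]; Delbourgo 1998 Prop. 4 [Delbourgo1998];
Rubin–Silverberg, "Families of elliptic curves with constant mod p representations" (1995) [folklore
pointer, not used in proofs].
-/

set_option autoImplicit false
set_option linter.dupNamespace false

noncomputable section

open scoped Classical MatrixGroups ModularForm

open CongruenceSubgroup WeierstrassCurve NumberField IsDedekindDomain Rat.HeightOneSpectrum
  Literature.NumberTheory.EllipticCurves
  Literature.NumberTheory.EllipticCurves.ModularForms
  Literature.NumberTheory.EllipticCurves.Rank1Residual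
  Literature.NumberTheory.EllipticCurves.Rank1Residual.Typed
  Literature.NumberTheory.EllipticCurves.GreenbergVatsal2000
  Literature.NumberTheory.EllipticCurves.EmertonPollackWeston2006
  Literature.NumberTheory.GaloisRepresentations

namespace Summit.BirchSwinnertonDyer.BirchSwinnertonDyer.Theorems.AdditiveBranchIMCGordTwoRankZeroCongruence

open Summit.BirchSwinnertonDyer.Rank1Residual.Additive
open Summit.BirchSwinnertonDyer.BirchSwinnertonDyer.Theses.AdditiveBranchIMC
open Summit.BirchSwinnertonDyer.BirchSwinnertonDyer.Theorems.AdditiveBranchIMCGordTwoRankZeroTransport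

variable {p : ℕ} [hp : Fact p.Prime]

/-! ## §1 The base case at the partner: Kato + a unit branch `p`-adic `L`-function -/

/-- An element of `Λ = ℤ_p⟦T⟧` whose image in `ℚ_p⟦T⟧` has a constant term of norm `1` is a unit of `Λ`.
[folklore] -/
theorem isUnit_of_norm_constantCoeff_iwasawaToPowerSeries_eq_one {g : IwasawaAlgebra p}
    (h : ‖PowerSeries.constantCoeff (iwasawaToPowerSeries p g)‖ = 1) : IsUnit g := by
  rw [PowerSeries.isUnit_iff_constantCoeff]
  rw [constantCoeff_iwasawaToPowerSeries, PadicInt.padic_norm_e_of_padicInt] at h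
  exact PadicInt.isUnit_iff.mpr h

/-- **Base case (EPW's statement 5.1.1 with `μ = λ = 0`) at a good ordinary curve whose branch `p`-adic
`L`-function is a unit.** For `V₁/ℚ` globally minimal, good ordinary at the odd prime `p` with
`ρ_{V₁,pⁿ}` onto for every `n` (Kato's integrality hypothesis (12.5.2)), IF for every newform / period
normalisation `(f₁, ϖ₁)` the constant term of `ϖ₁·L_p(f₁, α₁, ω^{(p−1)/2}, T)` (plus / minus symbols by
the parity of `(p−1)/2`) has `p`-adic norm `1` — certificate (C2), ONE modular-symbol value — THEN
`BranchCharIdealMuZeroEigen V₁ p`: for every eigen-datum, `X` is torsion and `char X = (g₁)` with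
`HasUnitContent g₁` and `ι g₁ = ϖ₁·L_br`. Proof: Kato's component reading `hK` gives `g ∈ char X` with
`ι g = u·ϖ₁·L_br`; its constant term is a unit, so `g ∈ Λ^×`, `char X = Λ`, and `g₁ := u⁻¹g` works.
[cite: Kato2004Asterisque, Thm. 17.4 (3) (p. 273)] [cite: EmertonPollackWeston2006, Thm. 5.1.2 and statement 5.1.1 (arXiv p30)] -/
theorem branchCharIdealMuZeroEigen_of_katoComponent_of_unit
    (hK : Kato2004.charIdeal_dvd_padicLFunctionBranch_component_of_surjective)
    (V₁ : WeierstrassCurve ℚ) [V₁.IsElliptic] [V₁.IsGloballyMinimal]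
    (hord : IsOrdinaryAt V₁ p) (hsurj : ∀ n : ℕ, V₁.HasSurjectiveModNGaloisRep (p ^ n : ℕ))
    (hunit : ∀ {N : ℕ} [NeZero N] (f : CuspForm (Gamma0 N) 2), IsNewformOf V₁ f → ∀ (ϖ : ℚ),
      (if Even (p / 2) then (ϖ : ℝ) * V₁.realPeriodRat = plusPeriod f
        else (ϖ : ℝ) * V₁.imaginaryPeriodRat = minusPeriod f) →
      ‖PowerSeries.constantCoeff (PowerSeries.C (ϖ : ℚ_[p]) *
        (if Even (p / 2) then padicLFunctionBranch f ((unitRoot V₁ p : ℤ_[p]) : ℚ_[p]) (p / 2)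
          else padicLFunctionMinusBranch f ((unitRoot V₁ p : ℤ_[p]) : ℚ_[p]) (p / 2)))‖ = 1) :
    BranchCharIdealMuZeroEigen V₁ p := by
  intro K _ _ _ F _ _ _ _ κ γ N _ f S hSγ X _ _ toDual hp2 hK2 hθ hκ hγ hcv hγK hγF hf hS hbij hT hC ϖ hϖ
  obtain ⟨htor, g, hgmem, u, hιg⟩ := hK p V₁ K F S hSγ X toDual hp2 hK2 hθ hord hsurj hκ hγ hcv hγK hγF
    hf hS hbij hT hC ϖ hϖ
  -- abbreviate the analytic object
  set B := (if Even (p / 2) then padicLFunctionBranch f ((unitRoot V₁ p : ℤ_[p]) : ℚ_[p]) (p / 2)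
    else padicLFunctionMinusBranch f ((unitRoot V₁ p : ℤ_[p]) : ℚ_[p]) (p / 2)) with hB
  have hcert := hunit f hf ϖ hϖ
  -- the constant term of `ι g` is `u` times that of `ϖ·B`, hence a unit
  have hgunit : IsUnit g := by
    apply isUnit_of_norm_constantCoeff_iwasawaToPowerSeries_eq_one
    have h1 : ‖PowerSeries.constantCoeff (PowerSeries.C (ϖ : ℚ_[p]) * B)‖ = 1 := hcert
    rw [map_mul, PowerSeries.constantCoeff_C] at h1
    have hu : ‖((u : ℤ_[p]) : ℚ_[p])‖ = 1 := by
      rw [PadicInt.padic_norm_e_of_padicInt]; exact PadicInt.isUnit_iff.mp (Units.isUnit u)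
    rw [hιg, map_mul, PowerSeries.constantCoeff_C, mul_assoc, norm_mul, hu, one_mul, h1]
  refine ⟨htor, PowerSeries.C (((u⁻¹ : ℤ_[p]ˣ) : ℤ_[p])) * g, ?_, ?_, ?_⟩
  · -- `char X = Λ = (u⁻¹ g)`
    have htop : Literature.NumberTheory.EllipticCurves.Module.charIdeal (IwasawaAlgebra p) X = ⊤ :=
      Ideal.eq_top_of_isUnit_mem _ hgmem hgunit
    rw [htop, eq_comm, Ideal.span_singleton_eq_top]
    exact ((Units.isUnit u⁻¹).map PowerSeries.C).mul hgunit
  · -- unit content: the constant coefficient is a unit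
    refine ⟨0, ?_⟩
    rw [PowerSeries.coeff_zero_eq_constantCoeff]
    exact PowerSeries.isUnit_iff_constantCoeff.mp (((Units.isUnit u⁻¹).map PowerSeries.C).mul hgunit)
  · rw [map_mul, hιg, ← mul_assoc, AdditiveBranchIMCGordTwoRankZeroLambdaAdic.iwasawaToPowerSeries_C,
      ← map_mul, ← mul_assoc, ← PadicInt.coe_mul, Units.inv_mul, PadicInt.coe_one, one_mul]

/-! ## §2 The transfer to the additive curve: the Λ-adic lower input from a partner -/

/-- **Even branch (`p ≡ 1 (mod 4)`, `p ≥ 5`): `ChiBranchLowerDivisibilityAt W p` from EPW Cor. 5.1.4 on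
the branch and a partner.** Let `W/ℚ` be potentially good at `p` (`0 ≤ ord_p j`), `V₁` a globally minimal
good ordinary PARTNER with `V₁[p]` irreducible satisfying EPW's 5.1.1 with `μ = 0` on the branch
(`hBr₁`, e.g. from §1), and suppose (C1): every good ordinary twist model `V` of `W` (`C • V^{(p)} = W`)
carries a `Γ_ℚ`-equivariant `V₁[p] ≃ V[p]`. Then for every such datum `char_Λ X(W/ℚ_∞) ⊆ (ϖ·L_p(f_V,
α, ω^{(p−1)/2}, T))` — the Skinner–Urban direction on the branch, `ChiBranchLowerDivisibilityAt W p` —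
by `hEPW` (5.1.1 for `f_V ⊗ ω^m`, eigenspace model) and the cell's prime-to-`p` descent
`SelmerDualData.exists_chiEigenInCyclotomic`. CONDITIONAL on the displayed certificates; closes nothing.
[cite: EmertonPollackWeston2006, Cor. 5.1.4 and Thm. 5.1.3 (arXiv p30)] [cite: GreenbergLNM1716, §5 (PDF p. 143)] -/
theorem chiBranchLowerDivisibilityAt_of_branchTransfer {W : WeierstrassCurve ℚ} [W.IsElliptic]
    (hEPW : EmertonPollackWeston2006.cor514_branchTransfer_of_torsionIso)
    (hp5 : 5 ≤ p) (hj : 0 ≤ padicValRat p W.j)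
    (V₁ : WeierstrassCurve ℚ) [V₁.IsElliptic] [V₁.IsGloballyMinimal]
    (hord₁ : IsOrdinaryAt V₁ p) (hirr₁ : V₁.HasIrreducibleModPGaloisRep p)
    (hBr₁ : BranchCharIdealMuZeroEigen V₁ p)
    (hiso : ∀ (V : WeierstrassCurve ℚ) [V.IsElliptic] [V.IsGloballyMinimal],
      (∃ C : VariableChange ℚ, C • V.quadraticTwist (p : ℚ) = W) → GoodOrd V p →
      ∃ e : geomTorsion V₁ (p : ℤ) ≃+ geomTorsion V (p : ℤ),
        ∀ (σ : Field.absoluteGaloisGroup ℚ) (P : geomTorsion V₁ (p : ℤ)), e (σ • P) = σ • e P) :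
    ChiBranchLowerDivisibilityAt W p := by
  intro V _ _ κ γ N _ f hp1 hCW hG hκ hγ hcv hf D ϖ hϖ g' hg'
  have hp2 : p ≠ 2 := by rintro rfl; norm_num at hp1
  have hpne : (p : ℚ) ≠ 0 := Nat.cast_ne_zero.mpr hp.out.ne_zero
  have heven : Even (p / 2) := ⟨p / 4, by omega⟩
  have hord : IsOrdinaryAt V p :=
    isOrdinaryAt_of_goodOrd_or_mult_of_model_twist W V hpne hCW hj (Or.inl hG)
  -- EPW: the partner's 5.1.1 passes to the twist model `V`
  have hBr : BranchCharIdealMuZeroEigen V p := hEPW p V₁ V hp5 hord₁ hord (hiso V hCW hG) hirr₁ hBr₁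
  obtain ⟨C, hC⟩ := hCW
  haveI hcycL : IsCyclotomicExtension {p} ℚ (CyclotomicField p ℚ) := by
    have h : (CyclotomicField.algebra p ℚ : Algebra ℚ (CyclotomicField p ℚ)) =
        DivisionRing.toRatAlgebra := Subsingleton.elim _ _
    exact h ▸ CyclotomicField.isCyclotomicExtension p ℚ
  obtain ⟨K, θ, hK2, hθ, hθ2⟩ := exists_intermediateField_sq_eq_pStar p (CyclotomicField p ℚ) hp2
  haveI : NumberField K := NumberField.of_module_finite ℚ K
  have hcK : θ ^ 2 = algebraMap ℚ K (p : ℚ) := by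
    rw [hθ2, pStar_eq_self_of_mod_four_eq_one hp1]
  haveI : IsGalois ℚ K := isGalois_of_finrank_eq_two K hK2
  haveI := normal_galRange K hK2 (sigmaQ_ne_one K hK2 hθ hcK)
  haveI := normal_galRange_cyclotomic p (CyclotomicField p ℚ)
  haveI : (V.quadraticTwist (p : ℚ)).IsElliptic := V.isElliptic_quadraticTwist hpne
  obtain ⟨γ', hγ'KF, hκγ', ⟨g₀, hg₀, hγ'eq⟩, D', hchar, htor⟩ :=
    SelmerDualData.exists_chiEigenInCyclotomic p (CyclotomicField p ℚ) V K hK2 hθ hcK κ hC hp2 D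
  obtain ⟨-, g, hspan, -, hιg⟩ := hBr K (CyclotomicField p ℚ) (κ := κ) (γ := γ') (f := f)
    (chiEigenSelmerIn V K p κ (galRange (K := ℚ) (CyclotomicField p ℚ)))
    (fun t ht ↦ conjH1_mem_chiEigenSelmerIn γ' ht) D'.X D'.toDual hp2 hK2 ⟨θ, hθ2⟩ hκ
    (isTopGenerator_of_kappa_eq κ hκγ' hγ)
    (isCyclotomicVariable_of_eq_mul p κ hκ hg₀ hγ'eq hcv)
    (Subgroup.mem_inf.mp hγ'KF).1 (Subgroup.mem_inf.mp hγ'KF).2 hf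
    (mem_chiEigenSelmerIn_iff_ite V K κ _) D'.bijective D'.toDual_T_smul D'.toDual_C_smul ϖ
    (by rw [if_pos heven]; exact hϖ)
  rw [if_pos heven] at hιg
  -- `g' ∈ char X(W/ℚ_∞) = (g)`
  have hg'mem : g' ∈ Ideal.span {g} := by rw [← hspan, hchar]; exact hg'
  obtain ⟨h, hh⟩ := Ideal.mem_span_singleton'.mp hg'mem
  refine ⟨h, ?_⟩
  rw [← hh, map_mul, hιg]

/-- **Odd branch (`p ≡ 3 (mod 4)`, `p ≥ 7`): `ChiBranchLowerDivisibilityOddAt W p` from EPW Cor. 5.1.4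
on the branch and a partner** (twist by `−p = p*`, minus symbols, `ϖ·|Ω⁻(V)| = Ω⁻_f`). Same proof as the
even twin with the odd descent of gen 0's `…LambdaAdicOdd`. CONDITIONAL on the displayed certificates;
closes nothing. [cite: EmertonPollackWeston2006, Cor. 5.1.4 and Thm. 5.1.3 (arXiv p30)] [cite: GreenbergLNM1716, §5 (PDF p. 143)] -/
theorem chiBranchLowerDivisibilityOddAt_of_branchTransfer {W : WeierstrassCurve ℚ} [W.IsElliptic]
    (hEPW : EmertonPollackWeston2006.cor514_branchTransfer_of_torsionIso)
    (hp5 : 5 ≤ p) (hj : 0 ≤ padicValRat p W.j)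
    (V₁ : WeierstrassCurve ℚ) [V₁.IsElliptic] [V₁.IsGloballyMinimal]
    (hord₁ : IsOrdinaryAt V₁ p) (hirr₁ : V₁.HasIrreducibleModPGaloisRep p)
    (hBr₁ : BranchCharIdealMuZeroEigen V₁ p)
    (hiso : ∀ (V : WeierstrassCurve ℚ) [V.IsElliptic] [V.IsGloballyMinimal],
      (∃ C : VariableChange ℚ, C • V.quadraticTwist (-(p : ℚ)) = W) → GoodOrd V p →
      ∃ e : geomTorsion V₁ (p : ℤ) ≃+ geomTorsion V (p : ℤ),
        ∀ (σ : Field.absoluteGaloisGroup ℚ) (P : geomTorsion V₁ (p : ℤ)), e (σ • P) = σ • e P) :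
    ChiBranchLowerDivisibilityOddAt W p := by
  intro V _ _ κ γ N _ f hp3 hCW hG hκ hγ hcv hf D ϖ hϖ g' hg'
  have hp2 : p ≠ 2 := by rintro rfl; norm_num at hp3
  have hpne : (-(p : ℚ)) ≠ 0 := neg_ne_zero.mpr (Nat.cast_ne_zero.mpr hp.out.ne_zero)
  have hodd : ¬ Even (p / 2) := by rw [Nat.not_even_iff_odd]; exact ⟨p / 4, by omega⟩
  have hord : IsOrdinaryAt V p :=
    isOrdinaryAt_of_goodOrd_or_mult_of_model_twist W V hpne hCW hj (Or.inl hG)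
  have hBr : BranchCharIdealMuZeroEigen V p := hEPW p V₁ V hp5 hord₁ hord (hiso V hCW hG) hirr₁ hBr₁
  obtain ⟨C, hC⟩ := hCW
  haveI hcycL : IsCyclotomicExtension {p} ℚ (CyclotomicField p ℚ) := by
    have h : (CyclotomicField.algebra p ℚ : Algebra ℚ (CyclotomicField p ℚ)) =
        DivisionRing.toRatAlgebra := Subsingleton.elim _ _
    exact h ▸ CyclotomicField.isCyclotomicExtension p ℚ
  obtain ⟨K, θ, hK2, hθ, hθ2⟩ := exists_intermediateField_sq_eq_pStar p (CyclotomicField p ℚ) hp2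
  haveI : NumberField K := NumberField.of_module_finite ℚ K
  have hcK : θ ^ 2 = algebraMap ℚ K (-(p : ℚ)) := by
    rw [hθ2, pStar_eq_neg_of_mod_four_eq_three hp3]
  haveI : IsGalois ℚ K := isGalois_of_finrank_eq_two K hK2
  haveI := normal_galRange K hK2 (sigmaQ_ne_one K hK2 hθ hcK)
  haveI := normal_galRange_cyclotomic p (CyclotomicField p ℚ)
  haveI : (V.quadraticTwist (-(p : ℚ))).IsElliptic := V.isElliptic_quadraticTwist hpne
  obtain ⟨γ', hγ'KF, hκγ', ⟨g₀, hg₀, hγ'eq⟩, D', hchar, htor⟩ :=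
    SelmerDualData.exists_chiEigenInCyclotomic p (CyclotomicField p ℚ) V K hK2 hθ hcK κ hC hp2 D
  obtain ⟨-, g, hspan, -, hιg⟩ := hBr K (CyclotomicField p ℚ) (κ := κ) (γ := γ') (f := f)
    (chiEigenSelmerIn V K p κ (galRange (K := ℚ) (CyclotomicField p ℚ)))
    (fun t ht ↦ conjH1_mem_chiEigenSelmerIn γ' ht) D'.X D'.toDual hp2 hK2 ⟨θ, hθ2⟩ hκ
    (isTopGenerator_of_kappa_eq κ hκγ' hγ)
    (isCyclotomicVariable_of_eq_mul p κ hκ hg₀ hγ'eq hcv)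
    (Subgroup.mem_inf.mp hγ'KF).1 (Subgroup.mem_inf.mp hγ'KF).2 hf
    (mem_chiEigenSelmerIn_iff_ite V K κ _) D'.bijective D'.toDual_T_smul D'.toDual_C_smul ϖ
    (by rw [if_neg hodd]; exact hϖ)
  rw [if_neg hodd] at hιg
  have hg'mem : g' ∈ Ideal.span {g} := by rw [← hspan, hchar]; exact hg'
  obtain ⟨h, hh⟩ := Ideal.mem_span_singleton'.mp hg'mem
  refine ⟨h, ?_⟩
  rw [← hh, map_mul, hιg]

/-! ## §3 Rank `0`: the lower half on cell (G-ord, `e = 2`) from the facts and a certified partner -/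

/-- **Cell (G-ord, `e = 2`), `p ≡ 1 (mod 4)`, `p ≥ 5`, `r_an = 0`: `ord_p #Ш(W)_an ≤ ord_p #Ш(W)` from the
facts, EPW's branch transfer and a partner** (`hBr₁`: the partner's 5.1.1 with `μ = 0`, e.g. §1 from `hK`
+ (C2); `hiso`: (C1)). Via §2 and gen 0's `missingLowerBoundAt_cellGordTwo_rankZero_of_chiBranchLowerDivisibility`
(Delbourgo 1998 Prop. 4 `hDelG`, Pal 2012 Thm. 3.2 `hPal`, GZK, modularity, a parametrisation datum).
[cite: EmertonPollackWeston2006, Cor. 5.1.4 (arXiv p30)] [cite: Delbourgo1998, Prop. 4 (p. 144)] [cite: Pal2012, Thm. 3.2]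
[cite: Miller2011LMS, Def. 1.1] -/
theorem missingLowerBoundAt_rankZero_of_branchTransfer {W : WeierstrassCurve ℚ} [W.IsElliptic]
    [W.IsGloballyMinimal]
    (hEPW : EmertonPollackWeston2006.cor514_branchTransfer_of_torsionIso)
    (hDelG : Delbourgo1998.prop4_rankZero_constantCoeff_eq_unit_mul_of_potGoodOrd)
    (hPal : Pal2012.thm32_sqrt_mul_realPeriodRat_twist_eq_of_prime_one_mod_four)
    (hGZK : rank_eq_analyticRank_of_analyticRank_le_one) (hmod : hasEntireLFunction_rat)
    (hmodD : nonempty_modularParametrizationData)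
    (hc : N10.CellGordTwo W p) (hp1 : p % 4 = 1) (hp5 : 5 ≤ p) (hr : W.analyticRank = 0)
    (V₁ : WeierstrassCurve ℚ) [V₁.IsElliptic] [V₁.IsGloballyMinimal]
    (hord₁ : IsOrdinaryAt V₁ p) (hirr₁ : V₁.HasIrreducibleModPGaloisRep p)
    (hBr₁ : BranchCharIdealMuZeroEigen V₁ p)
    (hiso : ∀ (V : WeierstrassCurve ℚ) [V.IsElliptic] [V.IsGloballyMinimal],
      (∃ C : VariableChange ℚ, C • V.quadraticTwist (p : ℚ) = W) → GoodOrd V p →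
      ∃ e : geomTorsion V₁ (p : ℤ) ≃+ geomTorsion V (p : ℤ),
        ∀ (σ : Field.absoluteGaloisGroup ℚ) (P : geomTorsion V₁ (p : ℤ)), e (σ • P) = σ • e P) :
    MissingLowerBoundAt W p :=
  missingLowerBoundAt_cellGordTwo_rankZero_of_chiBranchLowerDivisibility hDelG hPal hGZK hmod hmodD hc hp1
    hr (chiBranchLowerDivisibilityAt_of_branchTransfer hEPW hp5
      (padicValRat_j_nonneg_of_typeGOrd W p hc.2.2.1) V₁ hord₁ hirr₁ hBr₁ hiso)

/-- **Cell (G-ord, `e = 2`), `p ≡ 3 (mod 4)`, `p ≥ 7`, `r_an = 0`: the odd twin** (no Pal input: the odd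
Birch–Pal identity is a tree theorem). [cite: EmertonPollackWeston2006, Cor. 5.1.4 (arXiv p30)]
[cite: Delbourgo1998, Prop. 4 (p. 144)] [cite: Miller2011LMS, Def. 1.1] -/
theorem missingLowerBoundAt_rankZero_of_branchTransfer_odd {W : WeierstrassCurve ℚ} [W.IsElliptic]
    [W.IsGloballyMinimal]
    (hEPW : EmertonPollackWeston2006.cor514_branchTransfer_of_torsionIso)
    (hDelG : Delbourgo1998.prop4_rankZero_constantCoeff_eq_unit_mul_of_potGoodOrd)
    (hGZK : rank_eq_analyticRank_of_analyticRank_le_one) (hmod : hasEntireLFunction_rat)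
    (hmodD : nonempty_modularParametrizationData)
    (hc : N10.CellGordTwo W p) (hp3 : p % 4 = 3) (hp5 : 5 ≤ p) (hr : W.analyticRank = 0)
    (V₁ : WeierstrassCurve ℚ) [V₁.IsElliptic] [V₁.IsGloballyMinimal]
    (hord₁ : IsOrdinaryAt V₁ p) (hirr₁ : V₁.HasIrreducibleModPGaloisRep p)
    (hBr₁ : BranchCharIdealMuZeroEigen V₁ p)
    (hiso : ∀ (V : WeierstrassCurve ℚ) [V.IsElliptic] [V.IsGloballyMinimal],
      (∃ C : VariableChange ℚ, C • V.quadraticTwist (-(p : ℚ)) = W) → GoodOrd V p →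
      ∃ e : geomTorsion V₁ (p : ℤ) ≃+ geomTorsion V (p : ℤ),
        ∀ (σ : Field.absoluteGaloisGroup ℚ) (P : geomTorsion V₁ (p : ℤ)), e (σ • P) = σ • e P) :
    MissingLowerBoundAt W p :=
  missingLowerBoundAt_cellGordTwo_rankZero_of_chiBranchLowerDivisibilityOdd hDelG hGZK hmod hmodD hc hp3
    hr (chiBranchLowerDivisibilityOddAt_of_branchTransfer hEPW hp5
      (padicValRat_j_nonneg_of_typeGOrd W p hc.2.2.1) V₁ hord₁ hirr₁ hBr₁ hiso)

/-- **The crux's rows, `p ≡ 1 (mod 4)`: the lower half from the route's facts, Kato's component reading,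
EPW's branch transfer and the two certificates at a tower-surjective partner** — the shape a per-pair
booking would instantiate: PUBLISHED inputs by name (`PrintedFacts ⊇ {hGZK, hmod, hmodD}`, `ReadingFacts ⊇
{hDelG}`, `hPal`, `hK`, `hEPW`) + (C1) `hiso` + (C2) `hunit` at a partner `V₁` with `ρ_{V₁,pⁿ}` onto for all
`n`. Off-Case-1 or not, CM or not (the hypothesis `¬ HasCaseOneMember` of the crux is not needed).
[cite: EmertonPollackWeston2006, Cor. 5.1.4 (arXiv p30)] [cite: Kato2004Asterisque, Thm. 17.4 (3) (p. 273)]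
[cite: Delbourgo1998, Prop. 4 (p. 144)] [cite: Pal2012, Thm. 3.2] -/
theorem missingLowerBoundAt_offCaseOne_rankZero_of_partner {W : WeierstrassCurve ℚ} [W.IsElliptic]
    [W.IsGloballyMinimal] (hP : PrintedFacts) (hR : ReadingFacts)
    (hPal : Pal2012.thm32_sqrt_mul_realPeriodRat_twist_eq_of_prime_one_mod_four)
    (hK : Kato2004.charIdeal_dvd_padicLFunctionBranch_component_of_surjective)
    (hEPW : EmertonPollackWeston2006.cor514_branchTransfer_of_torsionIso)
    (hc : N10.CellGordTwo W p) (hp1 : p % 4 = 1) (hp5 : 5 ≤ p) (hr : W.analyticRank = 0)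
    (V₁ : WeierstrassCurve ℚ) [V₁.IsElliptic] [V₁.IsGloballyMinimal]
    (hord₁ : IsOrdinaryAt V₁ p) (hirr₁ : V₁.HasIrreducibleModPGaloisRep p)
    (hsurj₁ : ∀ n : ℕ, V₁.HasSurjectiveModNGaloisRep (p ^ n : ℕ))
    (hunit : ∀ {N : ℕ} [NeZero N] (f : CuspForm (Gamma0 N) 2), IsNewformOf V₁ f → ∀ (ϖ : ℚ),
      (if Even (p / 2) then (ϖ : ℝ) * V₁.realPeriodRat = plusPeriod f
        else (ϖ : ℝ) * V₁.imaginaryPeriodRat = minusPeriod f) →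
      ‖PowerSeries.constantCoeff (PowerSeries.C (ϖ : ℚ_[p]) *
        (if Even (p / 2) then padicLFunctionBranch f ((unitRoot V₁ p : ℤ_[p]) : ℚ_[p]) (p / 2)
          else padicLFunctionMinusBranch f ((unitRoot V₁ p : ℤ_[p]) : ℚ_[p]) (p / 2)))‖ = 1)
    (hiso : ∀ (V : WeierstrassCurve ℚ) [V.IsElliptic] [V.IsGloballyMinimal],
      (∃ C : VariableChange ℚ, C • V.quadraticTwist (p : ℚ) = W) → GoodOrd V p →
      ∃ e : geomTorsion V₁ (p : ℤ) ≃+ geomTorsion V (p : ℤ),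
        ∀ (σ : Field.absoluteGaloisGroup ℚ) (P : geomTorsion V₁ (p : ℤ)), e (σ • P) = σ • e P) :
    MissingLowerBoundAt W p := by
  obtain ⟨-, -, -, -, hGZK, hmod, hmodD, -⟩ := hP
  obtain ⟨-, -, -, -, hDelG⟩ := hR
  exact missingLowerBoundAt_rankZero_of_branchTransfer hEPW hDelG hPal hGZK hmod hmodD hc hp1 hp5 hr V₁ hord₁
    hirr₁ (branchCharIdealMuZeroEigen_of_katoComponent_of_unit hK V₁ hord₁ hsurj₁ hunit) hiso

end Summit.BirchSwinnertonDyer.BirchSwinnertonDyer.Theorems.AdditiveBranchIMCGordTwoRankZeroCongruence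

end
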